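import Summits.ABC.IUTFork.Cor312StatementBridge
import Summits.ABC.IUTFork.Cor312StatementBridges
import HarnessLib

/-!
# The fork at [IUTchIII] Corollary 3.12 — LOCAL versus GLOBAL readings of Step (xi): the witness (skeleton XXIVb)

Record-only file (D-0012) of the abc-iut cell (skeleton seat abc-iut-skel, gen 4); TAKES NO SIDE. Companion of
`ForkLocalGlobal` (XXIV), which states the quantifier fork of the cell's sufficient readings of Step (xi-f) of the proof
of [IUTchIII] Cor. 3.12 (kurims May 2020 = `paper:url-4b091feeb646`): every reading except R1 `RepresentedVol` is typed PER
PACKET (`∀ (j ∈ 𝔽_l^⋇) (v_ℚ ∈ 𝕍_ℚ)`: R0 pointwise volumes and R4 `IsoContainment` of `Cor312ReadingIso`, R2/R3 of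
`Cor312StatementBridge`, Team B's `VolumeTransport` of `Cor312LogKummerRoute`), while the print compares the two GLOBAL
numbers `−|log(Θ)|`, `−|log(q)|` ((xi-d) p. 183 display; (xi-f)/(xi-g) p. 184) and Step (xii) p. 185 l. 59 – p. 186 l. 3
disclaims local log-volume computations ("to work only with local Frobenioids means that one must contend with the
indeterminacy of not knowing whether … such a local Frobenioid object … corresponds to a given open submodule of the
log-shell at `v` or to, say, the `p_v^N`-multiple of this submodule … rendering meaningless any attempt to perform a
precise log-volume computation as in (xi)").

THE WITNESS (`LocalGlobal.lgSetting`, over abc-iut-c312-7's reusable toy parts `Cor312.Checks.toyIndex`/`toyShells`/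
`toySig`: `l⋇ = 2`, one place, the packets nontrivial `ℚ`-lines): hull frame = every nonempty region is a hull-set;
mono-analytic log-volume `−3` on regions inside `{0}`, `−1` on the others (monotone); at label `2 ∈ 𝔽_l^⋇` the Θ-pilot
Kummer images are `{0}` and the `q`-pilot image is everything, at label `1` the roles are swapped. PROVED: ALL of
abc-iut-c312-6's `BridgeHyps` (`lg_bridgeHyps`), "`|log(q)| > 0`" (`lg_absLogQPos`), the printed `Statement`
(`lg_statement`: `−|log(Θ)| = ((−1)+(−3))/2 = −2 = ((−3)+(−1))/2 = −|log(q)|` — the deficit at label `2` is set against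
the surplus at label `1` by the procession-normalized average of [IUTchIII] Prop. 3.9 (i)) AND the global reading R1
(`lg_representedVol`), while EVERY per-packet reading FAILS at label `2` (`lg_not_pointwise`, `lg_not_qRegion_subset_thetaHull`,
`lg_not_qRegion_mem_possibleImages`, `lg_not_isoContainment`, `lg_not_volumeTransport`; assembled: `fork`). With two
places instead of two labels the same bookkeeping runs place against place; the arithmetic meaning of the per-packet
surplus is XXIV's `perPlace_bound_of_pointwise` (per-packet reading ∘ the per-packet upper bound of [IUTchIV] Thm. 1.10
Step (v), kurims Apr 2020 `paper:url-56bcb0f95768` p. 28 = a per-place height bound). The witness is NOT a model of the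
initial Θ-data of [IUTchI] Def. 3.1 and says nothing about the intended instantiation; it shows the per-packet readings
are STRICTLY stronger than the Corollary at the level of the frozen definitions. [claim: Mochizuki2012, status: disputed]
Deliberately NOT here: the general theorems (XXIV); any judgement on (xi-f).
-/

noncomputable section

namespace Summit.ABC

namespace IUTFork

namespace Cor312Vol

open Thm311 Cor312 Literature.IUT.LogThetaLattice

namespace LocalGlobal

open Cor312.Checks

/-! ## 1. The toy packets (c312-7's `toyShells`: `ℚ`-lines) are nontrivial -/

/-- The fibre of the toy index over its one place is a one-point type. [folklore] -/
@[reducible] private def fibreUnique (vQ : toyIndex.VQ) : Unique (toyIndex.Fibre vQ) where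
  default := ⟨(), rfl⟩
  uniq := fun _ => Subtype.ext (Subsingleton.elim (α := Unit) _ _)

/-- The toy packet at `(j, v_ℚ)` is `ℚ`-linearly isomorphic to `ℚ` (cf. c312-9's `GapWitness.packetEquiv`). [folklore] -/
private def packetEquiv (j : toyIndex.Label) (vQ : toyIndex.VQ) : toyShells.Packet j vQ ≃ₗ[ℚ] ℚ :=
  haveI := fibreUnique vQ
  (PiTensorProduct.congr fun _ : toyIndex.Caps j =>
      LinearEquiv.funUnique (toyIndex.Fibre vQ) ℚ ℚ).trans
    (PiTensorProduct.constantBaseRingEquiv (toyIndex.Caps j) ℚ).toLinearEquiv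

/-- Hence the whole toy packet is not inside `{0}`. [folklore] -/
private theorem univ_not_subset_zero (j : toyIndex.Label) (vQ : toyIndex.VQ) :
    ¬ (Set.univ : Set (toyShells.Packet j vQ)) ⊆ {0} := by
  haveI : Nontrivial (toyShells.Packet j vQ) := (packetEquiv j vQ).symm.injective.nontrivial
  obtain ⟨x, hx⟩ := exists_ne (0 : toyShells.Packet j vQ)
  exact fun h => hx (h (Set.mem_univ x))

/-- The index `i = 0 ∈ Fin l⋇` of the label `1 ∈ 𝔽_l^⋇ = {1, 2}` of the toy (`l⋇ = 2`). [folklore] -/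
def iOne : Fin toyIndex.lstar := ⟨0, Nat.lt_of_lt_of_le Nat.zero_lt_two toyIndex.two_le_lstar⟩

/-- The index `i = 1 ∈ Fin l⋇` of the label `2 ∈ 𝔽_l^⋇ = {1, 2}` of the toy. [folklore] -/
def iTwo : Fin toyIndex.lstar := ⟨1, Nat.lt_of_lt_of_le Nat.one_lt_two toyIndex.two_le_lstar⟩

/-- `labelSucc iTwo = 2`. [folklore] -/
theorem labelSucc_iTwo : (Setting.labelSucc iTwo : toyIndex.Label) = 2 := by decide

/-- `labelSucc iOne = 1 ≠ 2`. [folklore] -/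
theorem labelSucc_iOne_ne_two : ¬ (Setting.labelSucc iOne : toyIndex.Label) = 2 := by decide

/-- The sum over `Fin l⋇ = Fin 2` of the toy, split at the two labels. [folklore] -/
private theorem sum_fin_lstar (f : Fin toyIndex.lstar → ℝ) :
    (∑ i, f i) / (toyIndex.lstar : ℝ) = (f iOne + f iTwo) / 2 := by
  show (∑ i : Fin 2, f i) / ((2 : ℕ) : ℝ) = _
  rw [Fin.sum_univ_two]
  rfl

/-! ## 2. Data: log-volume `−3` inside `{0}`, `−1` outside; the NONEMPTY hull frame -/

open scoped Classical in
/-- The log-volume of the witness: `−3` on subsets of `{0}`, `−1` on every other region (monotone). [folklore] -/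
def lgVol (j : toyIndex.Label) (vQ : toyIndex.VQ) (A : Set (toyShells.Packet j vQ)) : ℝ :=
  if A ⊆ {0} then -3 else -1

/-- `lgVol` of a subset of `{0}` is `−3`. [folklore] -/
theorem lgVol_of_subset {j : toyIndex.Label} {vQ : toyIndex.VQ} {A : Set (toyShells.Packet j vQ)}
    (h : A ⊆ {0}) : lgVol j vQ A = -3 := if_pos h

/-- `lgVol` of the whole packet is `−1`. [folklore] -/
theorem lgVol_univ (j : toyIndex.Label) (vQ : toyIndex.VQ) : lgVol j vQ Set.univ = -1 :=
  if_neg (univ_not_subset_zero j vQ)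

/-- `lgVol` is monotone on all regions. [folklore] -/
theorem lgVol_mono {j : toyIndex.Label} {vQ : toyIndex.VQ} {A B : Set (toyShells.Packet j vQ)} (hAB : A ⊆ B) :
    lgVol j vQ A ≤ lgVol j vQ B := by
  unfold lgVol
  by_cases hB : B ⊆ {0}
  · rw [if_pos (hAB.trans hB), if_pos hB]
  · rw [if_neg hB]; split_ifs <;> norm_num

/-- Data (a)(b)(c) of the witness: everything admissible, log-volume `lgVol`. [folklore] -/
def lgData : MRData toyShells where
  shellPk := fun _ _ => Set.univ
  shellSub := fun _ _ => Set.univ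
  Adm := fun _ _ _ => True
  logvol := fun j vQ A => lgVol j vQ A
  Ψ := fun _ _ => ∅
  act := fun _ _ _ => 0
  Mmod := fun _ => ∅

/-- The witness situation (the same data on every vertical line; c312-7's toy degrees). [folklore] -/
def lgSituation : Situation toyIndex where
  L := toyShells
  D := fun _ => lgData
  G := fun _ j => toyDegrees j

/-- The NONEMPTY hull frame: every nonempty region is a hull-set (hence its own holomorphic hull), every region is
relatively compact, a region admits a hull iff it is nonempty. [folklore] -/
def lgFrame (X : Type) [Zero X] : HullFrame X where
  Hul := {H | H.Nonempty}
  IsBounded := fun _ => True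
  HasHull := fun U => U.Nonempty
  hul_bounded := fun _ _ => trivial
  bounded_mono := fun _ _ _ _ => trivial
  exists_hul := fun U _ => ⟨Set.univ, Set.univ_nonempty, Set.subset_univ U⟩
  hull_mem := fun U _ hU =>
    (hU.mono (Set.subset_sInter fun _ hH => hH.2) : (⋂₀ {H | H ∈ {H : Set X | H.Nonempty} ∧ U ⊆ H}).Nonempty)

/-- In the nonempty frame the hull of a nonempty region is the region itself. [folklore] -/
theorem lgFrame_hull {X : Type} [Zero X] {U : Set X} (hU : U.Nonempty) : (lgFrame X).hull U = U :=
  Set.Subset.antisymm ((lgFrame X).hull_subset_of_mem hU Set.Subset.rfl) ((lgFrame X).subset_hull U)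

/-! ## 3. The setting: Θ- and `q`-pilot regions swapped between the two labels `𝔽_l^⋇ = {1, 2}` -/

/-- The WITNESS SETTING over `lgSituation` (`l⋇ = 2`, one place): at label `2` the Θ-pilot Kummer image is `{0}` (volume
`−3`) and the `q`-pilot image everything (`−1`); at the other labels the roles are swapped. One-point lattice/pilot
data as in c312-7's toys; hull frame `lgFrame`. [folklore] -/
def lgSetting : Setting lgSituation where
  n := 0
  HT := ℤ × ℤ
  LogLink := fun _ _ => Unit
  IsFull := fun _ => True
  lattice :=
    { theater := fun n m => (n, m)
      distinct := fun p q h => by simpa using h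
      logLink := fun _ _ => ()
      logLink_full := fun _ _ => trivial }
  Frd := Unit
  IsoF := fun _ _ => Unit
  Ob := fun _ => Unit
  realify := id
  Strip := Unit
  IsoS := fun _ _ => Unit
  M := fun _ _ => Unit
  sig := toySig
  split := { Msplit := fun _ _ => ⊤, exists_gen := fun _ _ => ⟨⟨(), trivial⟩, top_unit_isGenerator _⟩ }
  ObΔ := Unit
  N := fun _ _ => Unit
  qData := { q := fun _ _ => (), q_gen := fun _ _ => unit_isGenerator _, objOf := fun _ => () }
  frame := fun _ _ => lgFrame _
  hul_adm := fun _ _ _ _ => trivial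
  thetaRegionOf := fun _ _ j _ => if j = 2 then {0} else Set.univ
  qRegionOf := fun _ j _ => if j = 2 then Set.univ else {0}
  qRegion_mem := fun j _ => by
    show (if j = 2 then Set.univ else {0} : Set _).Nonempty
    split_ifs
    · exact Set.univ_nonempty
    · exact Set.singleton_nonempty 0
  qSupport_finite := fun _ => Set.toFinite _

/-- The (Ind3)-enlarged Θ-region of the witness (the Kummer images do not depend on `m`). [folklore] -/
theorem lg_thetaRegion3 (j : toyIndex.Label) (vQ : toyIndex.VQ) :
    lgSetting.thetaRegion3 j vQ = if j = 2 then {0} else Set.univ := by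
  unfold Setting.thetaRegion3 Setting.thetaRegion
  exact Set.iUnion_const _

/-- It is nonempty. [folklore] -/
theorem lg_thetaRegion3_nonempty (j : toyIndex.Label) (vQ : toyIndex.VQ) : (lgSetting.thetaRegion3 j vQ).Nonempty := by
  rw [lg_thetaRegion3]
  split_ifs
  · exact Set.singleton_nonempty 0
  · exact Set.univ_nonempty

/-- Every possible image of the witness IS the (Ind3)-enlarged region (`{0}`, `univ` are fixed by linear automorphisms);
so the coarse-space hypothesis of §2 holds here trivially. [folklore] -/
theorem lg_eq_of_mem_possibleImages {j : toyIndex.Label} {vQ : toyIndex.VQ} {U : Set (lgSituation.L.Packet j vQ)}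
    (hU : U ∈ lgSetting.possibleImages j vQ) : U = lgSetting.thetaRegion3 j vQ := by
  obtain ⟨Φ, -, rfl⟩ := hU
  rw [lg_thetaRegion3]
  split_ifs
  · rw [Set.image_singleton, map_zero]
  · exact Set.image_univ_of_surjective (Φ j vQ).surjective

/-- Hence the union of the possible images is that region … [folklore] -/
theorem lg_sUnion_possibleImages (j : toyIndex.Label) (vQ : toyIndex.VQ) :
    ⋃₀ lgSetting.possibleImages j vQ = lgSetting.thetaRegion3 j vQ :=
  Set.Subset.antisymm (Set.sUnion_subset fun _ hU => (lg_eq_of_mem_possibleImages hU).le)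
    (Set.subset_sUnion_of_mem (lgSetting.thetaRegion3_mem_possibleImages j vQ))

/-- … and so is its holomorphic hull. [folklore] -/
theorem lg_thetaHull (j : toyIndex.Label) (vQ : toyIndex.VQ) :
    lgSetting.thetaHull j vQ = lgSetting.thetaRegion3 j vQ := by
  unfold Setting.thetaHull
  rw [lg_sUnion_possibleImages]
  exact lgFrame_hull (lg_thetaRegion3_nonempty j vQ)

/-- Every packet union admits its hull. [folklore] -/
theorem lg_hullDefined (j : toyIndex.Label) (vQ : toyIndex.VQ) : lgSetting.HullDefined j vQ :=
  ⟨trivial, by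
    show (⋃₀ lgSetting.possibleImages j vQ).Nonempty
    rw [lg_sUnion_possibleImages]; exact lg_thetaRegion3_nonempty j vQ⟩

/-- The local Θ-volume of the witness: `−3` at label `2`, `−1` elsewhere. [folklore] -/
theorem lg_thetaLocal (j : toyIndex.Label) (vQ : toyIndex.VQ) :
    lgSetting.thetaLocal j vQ = ((if j = 2 then (-3 : ℝ) else -1 : ℝ) : WithTop ℝ) := by
  unfold Setting.thetaLocal
  rw [if_pos (lg_hullDefined j vQ), lg_thetaHull, lg_thetaRegion3]
  show ((lgVol j vQ (if j = 2 then {0} else Set.univ) : ℝ) : WithTop ℝ) = _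
  split_ifs
  · rw [lgVol_of_subset Set.Subset.rfl]
  · rw [lgVol_univ]

/-- The local `q`-volume of the witness: `−1` at label `2`, `−3` elsewhere. [folklore] -/
theorem lg_qLocal (j : toyIndex.Label) (vQ : toyIndex.VQ) :
    lgSetting.qLocal j vQ = if j = 2 then (-1 : ℝ) else -3 := by
  show lgVol j vQ (if j = 2 then Set.univ else {0}) = _
  split_ifs
  · exact lgVol_univ j vQ
  · exact lgVol_of_subset Set.Subset.rfl

/-- The witness is `ThetaFinite`. [folklore] -/
theorem lg_thetaFinite : lgSetting.ThetaFinite :=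
  ⟨fun i vQ => by rw [lg_thetaLocal]; exact WithTop.coe_ne_top, fun _ => Set.toFinite _⟩

/-- `−|log(Θ)| = ((−1) + (−3))/2 = −2` in the witness (the average over `j ∈ 𝔽_l^⋇ = {1, 2}`). [folklore] -/
theorem lg_negLogTheta : lgSetting.negLogTheta = ((-2 : ℝ) : WithTop ℝ) := by
  rw [lgSetting.negLogTheta_eq_of_thetaFinite lg_thetaFinite]
  congr 1
  simp only [lg_thetaLocal, WithTop.untopD_coe, finsum_unique]
  unfold processionNormalized
  rw [sum_fin_lstar, if_neg labelSucc_iOne_ne_two, if_pos labelSucc_iTwo]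
  norm_num

/-- `−|log(q)| = ((−3) + (−1))/2 = −2` in the witness. [folklore] -/
theorem lg_negLogQ : lgSetting.negLogQ = -2 := by
  unfold Setting.negLogQ
  simp only [lg_qLocal, finsum_unique]
  unfold processionNormalized
  rw [sum_fin_lstar, if_neg labelSucc_iOne_ne_two, if_pos labelSucc_iTwo]
  norm_num

/-- **The printed Statement HOLDS in the witness** (`−2 ≤ −2`: the deficit at label `2` is set against the surplus at
label `1` by the procession-normalized average). [folklore] -/
theorem lg_statement : lgSetting.Statement :=
  (lgSetting.statement_iff_real lg_negLogTheta).mpr (by rw [lg_negLogQ])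

/-- "`|log(q)| > 0`" holds in the witness. [folklore] -/
theorem lg_absLogQPos : lgSetting.AbsLogQPos := by
  show lgSetting.negLogQ < 0
  rw [lg_negLogQ]; norm_num

/-- **ALL of c312-6's bridge hypotheses hold in the witness.** [folklore] -/
theorem lg_bridgeHyps : BridgeHyps lgSetting where
  mono := fun _ _ _ _ _ _ hAB => lgVol_mono hAB
  image_adm := fun _ _ _ _ => trivial
  image_fin := fun _ => Set.toFinite _
  hul_nonempty := fun _ _ _ hH => hH
  theta_nonempty := fun _ vQ => lg_thetaRegion3_nonempty _ vQ
  finite := lg_thetaFinite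

/-- The coarse-space hypothesis of §2 holds in the witness (every possible image is the (Ind3)-union). [folklore] -/
theorem lg_coarse (i : Fin toyIndex.lstar) (vQ : toyIndex.VQ) :
    ∀ U ∈ lgSetting.possibleImages (Setting.labelSucc i) vQ,
      (lgSituation.D lgSetting.n).logvol _ vQ U =
        (lgSituation.D lgSetting.n).logvol _ vQ (lgSetting.thetaRegion3 (Setting.labelSucc i) vQ) :=
  fun _ hU => by rw [lg_eq_of_mem_possibleImages hU]

/-- **The GLOBAL reading R1 HOLDS in the witness**: the one assembled volume is `((−1)+(−3))/2 = −2 = −|log(q)|`. [folklore] -/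
theorem lg_representedVol : (toCor312Setting lg_bridgeHyps).RepresentedVol := by
  refine ⟨⟨fun t => lgSetting.thetaRegion3 _ t.2, fun t => lgSetting.thetaRegion3_mem_possibleImages _ t.2⟩, ?_⟩
  rw [toCor312Setting_negAbsLogq]
  show (toLocalFamily lgSetting lg_bridgeHyps.mono).assemble.logvol
      (Set.univ.pi fun t : Fin toyIndex.lstar × toyIndex.VQ => lgSetting.thetaRegion3 (Setting.labelSucc t.1) t.2) = _
  rw [LocalFamily.assemble_logvol_pi _ _ fun t : Fin toyIndex.lstar × toyIndex.VQ => lg_thetaRegion3_nonempty _ t.2]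
  show ∑ᶠ t : Fin toyIndex.lstar × toyIndex.VQ,
      (1 / (toyIndex.lstar : ℝ)) * lgVol _ t.2 (lgSetting.thetaRegion3 (Setting.labelSucc t.1) t.2) = _
  rw [finsum_eq_processionNormalized
    (fun t : Fin toyIndex.lstar × toyIndex.VQ => lgVol _ t.2 (lgSetting.thetaRegion3 (Setting.labelSucc t.1) t.2))
    (fun _ => Set.toFinite _), lg_negLogQ]
  simp only [lg_thetaRegion3, finsum_unique]
  unfold processionNormalized
  rw [sum_fin_lstar, if_neg labelSucc_iOne_ne_two, if_pos labelSucc_iTwo]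
  show (lgVol _ () (Set.univ : Set (toyShells.Packet (Setting.labelSucc iOne) ())) +
      lgVol _ () ({0} : Set (toyShells.Packet (Setting.labelSucc iTwo) ()))) / 2 = -2
  rw [lgVol_univ, lgVol_of_subset Set.Subset.rfl]
  norm_num

/-- **READING 0 FAILS in the witness**: at label `2` the `q`-volume `−1` exceeds the hull volume `−3`. [folklore] -/
theorem lg_not_pointwise :
    ¬ ∀ (i : Fin toyIndex.lstar) (vQ : toyIndex.VQ),
      lgSetting.qLocal (Setting.labelSucc i) vQ ≤ (lgSetting.thetaLocal (Setting.labelSucc i) vQ).untopD 0 := by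
  intro h
  have h1 := h iTwo ()
  rw [lg_qLocal, lg_thetaLocal, WithTop.untopD_coe, if_pos labelSucc_iTwo, if_pos labelSucc_iTwo] at h1
  norm_num at h1

/-- READING 2 fails in the witness (at label `2`: `univ ⊄ {0}`). [folklore] -/
theorem lg_not_qRegion_subset_thetaHull :
    ¬ ∀ (i : Fin toyIndex.lstar) (vQ : toyIndex.VQ),
      lgSetting.qRegion (Setting.labelSucc i) vQ ⊆ lgSetting.thetaHull (Setting.labelSucc i) vQ :=
  fun h => univ_not_subset_zero _ () (by
    have h2 := h iTwo ()
    rw [lg_thetaHull, lg_thetaRegion3, if_pos labelSucc_iTwo] at h2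
    revert h2
    show (if (Setting.labelSucc iTwo : toyIndex.Label) = 2 then Set.univ else ({0} : Set _)) ⊆ {0} → Set.univ ⊆ {0}
    rw [if_pos labelSucc_iTwo]; exact id)

/-- READING 3 fails in the witness. [folklore] -/
theorem lg_not_qRegion_mem_possibleImages :
    ¬ ∀ (i : Fin toyIndex.lstar) (vQ : toyIndex.VQ),
      lgSetting.qRegion (Setting.labelSucc i) vQ ∈ lgSetting.possibleImages (Setting.labelSucc i) vQ :=
  fun h => lg_not_qRegion_subset_thetaHull fun i vQ =>
    (Set.subset_sUnion_of_mem (h i vQ)).trans ((lgSetting.frame _ vQ).subset_hull _)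

/-- READING 4 (`IsoContainment` of `Cor312ReadingIso`, shape restated inline) fails in the witness: at label `2` every
region inside the hull `{0}` has volume `−3 ≠ −1`. [folklore] -/
theorem lg_not_isoContainment :
    ¬ ∀ (i : Fin toyIndex.lstar) (vQ : toyIndex.VQ),
      ∃ R' : Set (lgSituation.L.Packet (Setting.labelSucc i) vQ),
        R' ⊆ lgSetting.thetaHull (Setting.labelSucc i) vQ ∧
          (lgSituation.D lgSetting.n).Adm (Setting.labelSucc i) vQ R' ∧
            (lgSituation.D lgSetting.n).logvol (Setting.labelSucc i) vQ R' = lgSetting.qLocal (Setting.labelSucc i) vQ := by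
  intro h
  obtain ⟨R', hsub, -, hvol⟩ := h iTwo ()
  rw [lg_thetaHull, lg_thetaRegion3, if_pos labelSucc_iTwo] at hsub
  rw [lg_qLocal, if_pos labelSucc_iTwo] at hvol
  have h3 : lgVol _ () R' = -3 := lgVol_of_subset hsub
  have : (-3 : ℝ) = -1 := h3.symm.trans hvol
  norm_num at this

/-- `VolumeTransport` (Team B's B-INPUT, `Cor312LogKummerRoute`, shape restated inline) fails in the witness: at label `2`
every single Kummer image is `{0}`, of volume `−3 < −1`. [folklore] -/
theorem lg_not_volumeTransport :
    ¬ ∀ (i : Fin toyIndex.lstar) (vQ : toyIndex.VQ), ∃ m : ℤ,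
      lgSetting.qLocal (Setting.labelSucc i) vQ ≤
        (lgSituation.D lgSetting.n).logvol (Setting.labelSucc i) vQ (lgSetting.thetaRegion m (Setting.labelSucc i) vQ) := by
  intro h
  obtain ⟨m, hm⟩ := h iTwo ()
  rw [lg_qLocal, if_pos labelSucc_iTwo] at hm
  have h3 : (lgSituation.D lgSetting.n).logvol (Setting.labelSucc iTwo) ()
      (lgSetting.thetaRegion m (Setting.labelSucc iTwo) ()) = -3 :=
    lgVol_of_subset (by
      show (if (Setting.labelSucc iTwo : toyIndex.Label) = 2 then ({0} : Set _) else Set.univ) ⊆ {0}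
      rw [if_pos labelSucc_iTwo]; exact Set.Subset.rfl)
  rw [h3] at hm
  norm_num at hm

/-- **THE LOCAL/GLOBAL FORK, kernel form.** A verbatim `Cor312.Setting` satisfying all bridge hypotheses, "`|log(q)| > 0`",
the printed Statement of Cor. 3.12 AND the global reading R1, in which the per-packet readings R0 (pointwise volumes), R2,
R3 FAIL (R4, `VolumeTransport`: `lg_not_isoContainment`, `lg_not_volumeTransport`). The per-packet readings are strictly
stronger than the (global) Corollary: what they add is the family of per-place inequalities of §1.
[claim: Mochizuki2012, status: disputed] -/
theorem fork :
    ∃ (H : BridgeHyps lgSetting), lgSetting.AbsLogQPos ∧ lgSetting.Statement ∧ (toCor312Setting H).RepresentedVol ∧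
      (¬ ∀ (i : Fin toyIndex.lstar) (vQ : toyIndex.VQ),
        lgSetting.qLocal (Setting.labelSucc i) vQ ≤ (lgSetting.thetaLocal (Setting.labelSucc i) vQ).untopD 0) ∧
      (¬ ∀ (i : Fin toyIndex.lstar) (vQ : toyIndex.VQ),
        lgSetting.qRegion (Setting.labelSucc i) vQ ⊆ lgSetting.thetaHull (Setting.labelSucc i) vQ) ∧
      ¬ ∀ (i : Fin toyIndex.lstar) (vQ : toyIndex.VQ),
        lgSetting.qRegion (Setting.labelSucc i) vQ ∈ lgSetting.possibleImages (Setting.labelSucc i) vQ :=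
  ⟨lg_bridgeHyps, lg_absLogQPos, lg_statement, lg_representedVol, lg_not_pointwise,
    lg_not_qRegion_subset_thetaHull, lg_not_qRegion_mem_possibleImages⟩

end LocalGlobal

end Cor312Vol

end IUTFork

end Summit.ABC

end
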